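import Summits.QuantumFields.BalabanUV.Beta.FP.PerfectSecondOrderTablesInf

/-!
# Road FP, RULING R-FP-50 (b) row END-REBASE, part 1: THE PIN `StPin` OF THE END's FREE STENCIL (j, m)-FAMILY — `m = 1` the literal's stencils,
# `m ≥ 2` CONSTANT IN UNITS (the S-side twin of leaf-02's `PerfectSecondOrderTablesInf` §4 `WtPin`)

WHY.  RULING R-FP-50 (journal 2026-08-21T20:14Z [D1P3-G16-RFP50]) (b): the FREE-S END of road FP (L3 `RoadLeftLiteralGhost.d1Drift_JsB12Sym_of_sliceLedger_ghost`) is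
consumed with the S-family of record `S j 1 := (JsB12Sym …).S` (R-FP-41 (1), `m = 1`) and, for `m ≥ 2`, `S j m := counitS_j (SfoldComp m)` — the level-`j` family whose
unit-rescaling IS the supplied composite object, CONSTANT IN UNITS, so that `SPerfOf S m = SfoldComp m` and the X1m-S rows for `m ≥ 2` are rows of a constant family; `Wt j m`
likewise with `WtComp` through leaf-02's `WtPin`.  This file is the S-side pin and its bookkeeping, for an ARBITRARY supplied level object `Sinf : ℕ → …` (leaf-02's
`SfoldComp` when it lands):

* §1 `StPin Lc S₁ Sinf j m := if m = 1 then S₁ j else unitS (sfStep Lc j)⁻¹ (smStep d Lc j)⁻¹ (Sinf m)`; `StPin_one` (the END's `hSt1` shape), `StPin_of_ne_one`,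
  `unitS_StPin_of_ne_one` (constant in units, `unitS_unitS_inv`), **`sPerfOf_StPin_of_ne_one : m ≠ 1 → SPerfOf (sfStep Lc) (smStep d Lc) (StPin Lc S₁ Sinf) m = Sinf m`**
  (`limStOf` of a constant family), `sPerfOf_StPin_one` (at `m = 1` the END's object is unchanged).
* §2 THE `m ≥ 2` X1m-S ROWS OF THE PINNED FAMILY AS THEOREMS: `locStencil_unitS_StPin_of_ne_one` (the END's `hSm m`, from ONE `LocStencil (Sinf m)` letter),
  `locStencil_unitS_StPin_sub_of_ne_one` (the END's `hSmall m` with rate constant `0`: the unit-rescaled differences VANISH), `StPin_translate_of_ne_one` (the END's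
  `hcov2 m` from the `Lc^m`-covariance letter of `Sinf m`: `unitS` commutes with `shiftK`).
* §3 THE END's PERFECT OBJECTS UNDER THE TWO PINS AS ONE PIECEWISE OBJECT PER `m`: `SPerfPin Lc S₁ Sinf m := if m = 1 then SPerfOf … (fun j _ => S₁ j) 1 else Sinf m`,
  `WPerfPin Lc W₁ Winf m := if m = 1 then WPerfOf … (fun j _ => W₁ j) 1 else Winf m`, with **`sPerfOf_StPin : SPerfOf … (StPin Lc S₁ Sinf) = SPerfPin Lc S₁ Sinf`** and
  **`wPerfOf_WtPin : WPerfOf … (WtPin Lc W₁ Winf) = WPerfPin Lc W₁ Winf`** — the rewriting letters by which the re-based END (part 2) states its `m`-rows (`hfar`, `hslice`,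
  `hSDF`, `hsplit`) on the piecewise objects, i.e. for `m ≥ 2` DIRECTLY ON THE SUPPLIED COMPOSITE OBJECTS.

HONEST: [our object — bookkeeping] three `if`-definitions and their one-line readings; asserts nothing about (SDF), the composite objects, or their letters; 0∕4 row-D1 binders;
NOT the END re-base itself (part 2, `RoadLeftLiteralSComp`), NOT SDF, NOT D1, NOT BetaPertH, NOT continuum, NOT Clay.  HONEST DEPENDENCY: continuum YM on T⁴ ⇐ BetaPertH ∧
nine spine estimates (0/9 proved); BetaPertH ⇐ (D1) ∧ (D4) ∧ CAP+tail; G-an2-4 gates asym, D1 and NE2/3/4.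
Provenance: D1 formalisation swarm LEAF PROVER 06, unit b2b-balaban-beta-d1-formalise-leaf-06 gen 15, 2026-08-21.
-/

noncomputable section

namespace Summit.QuantumFields.BalabanUV.Beta.FP.PerfectStencilPin

open Filter Topology
open Literature.MathematicalPhysics.QuantumFieldTheory
open Literature.MathematicalPhysics.QuantumFieldTheory.Balaban1983to89
open Literature.MathematicalPhysics.QuantumFieldTheory.Balaban1983to89.Beta
open ExpKernelCalculus (MKer shiftK)
open AffineAveraging (Site)
open OneStepResolventKernel (Fib LocStencil)
open HessKerDressedLimit (limStOf limStOf_apply limMKerOf_eq_of_tendsto)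
open Summit.QuantumFields.BalabanUV.Beta.HessKerDressedUnits (unitS unitS_apply)
open Summit.QuantumFields.BalabanUV.Beta.D1BFx.UnitsOnlyK (unitS_unitS_inv)
open Summit.QuantumFields.BalabanUV.Beta.GAN24.CombesThomas (sfStep smStep sfStep_ne_zero smStep_ne_zero)
open Summit.QuantumFields.BalabanUV.Beta.FP.PerfectObjectsT (SPerfOf WPerfOf)
open Summit.QuantumFields.BalabanUV.Beta.FP.PerfectSecondOrderTablesInf (WtPin wPerfOf_WtPin_one wPerfOf_WtPin_of_ne_one)

variable {d : ℕ}

/-! ## §1 The pin and its readings -/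

section Pin

variable (Lc : ℕ) [NeZero Lc]
  (S₁ : ℕ → Fin (d + 1) → Site (d + 1) → MKer (d + 1) (Fib d))
  (Sinf : ℕ → Fin (d + 1) → Site (d + 1) → MKer (d + 1) (Fib d))

/-- [our object] **THE PIN OF THE END's FREE STENCIL (j, m)-FAMILY** (R-FP-50 (b)): at `m = 1` the supplied level-`j` stencils `S₁ j` (the END's `hSt1`: `(JsB12Sym … j).S`);
at `m ≠ 1` the level-`j` stencil family whose unit-rescaling IS the supplied object `Sinf m` — `unitS (sfStep Lc j)⁻¹ (smStep d Lc j)⁻¹ (Sinf m)` («`counitS_j (Sinf m)`»,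
constant in units). -/
def StPin (j m : ℕ) : Fin (d + 1) → Site (d + 1) → MKer (d + 1) (Fib d) :=
  if m = 1 then S₁ j else unitS (sfStep Lc j)⁻¹ (smStep d Lc j)⁻¹ (Sinf m)

omit [NeZero Lc] in
/-- [folklore] **THE END's `hSt1` SHAPE**: `StPin Lc S₁ Sinf j 1 = S₁ j`. -/
theorem StPin_one (j : ℕ) : StPin Lc S₁ Sinf j 1 = S₁ j := if_pos rfl

omit [NeZero Lc] in
/-- [folklore] Off `m = 1` the pin is the inverse-unit image of the supplied object. -/
theorem StPin_of_ne_one {m : ℕ} (hm : m ≠ 1) (j : ℕ) : StPin Lc S₁ Sinf j m = unitS (sfStep Lc j)⁻¹ (smStep d Lc j)⁻¹ (Sinf m) := if_neg hm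

/-- [folklore] **CONSTANT IN UNITS**: for `m ≠ 1` and every `j`, `unitS (sfStep Lc j) (smStep d Lc j) (StPin Lc S₁ Sinf j m) = Sinf m` (`unitS_unitS_inv`). -/
theorem unitS_StPin_of_ne_one {m : ℕ} (hm : m ≠ 1) (j : ℕ) : unitS (sfStep Lc j) (smStep d Lc j) (StPin Lc S₁ Sinf j m) = Sinf m := by
  rw [StPin_of_ne_one Lc S₁ Sinf hm j]
  exact unitS_unitS_inv (sfStep_ne_zero j) (smStep_ne_zero (d := d) j) (Sinf m)

/-- [our object — bookkeeping] **THE END's PERFECT m-FOLD STENCILS ARE THE SUPPLIED OBJECT** for `m ≠ 1`: `SPerfOf (sfStep Lc) (smStep d Lc) (StPin Lc S₁ Sinf) m = Sinf m`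
(`SPerfOf` = `limStOf` of the unit-rescaled family, which is CONSTANT `= Sinf m`).  With `Sinf := SfoldComp` (leaf-02, R-FP-50 (a)) the END's `m ≥ 2` rows become statements about
ONE explicit object per `m`.  Asserts nothing about (SDF). -/
theorem sPerfOf_StPin_of_ne_one {m : ℕ} (hm : m ≠ 1) : SPerfOf (sfStep Lc) (smStep d Lc) (StPin Lc S₁ Sinf) m = Sinf m := by
  unfold SPerfOf
  have e : (fun j => unitS (sfStep Lc j) (smStep d Lc j) (StPin Lc S₁ Sinf j m)) = fun _ => Sinf m :=
    funext fun j => unitS_StPin_of_ne_one Lc S₁ Sinf hm j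
  rw [e]
  funext κ u
  rw [limStOf_apply]
  exact limMKerOf_eq_of_tendsto fun x z a b => tendsto_const_nhds

omit [NeZero Lc] in
/-- [folklore] **AT `m = 1` THE END's OBJECT IS UNCHANGED**: `SPerfOf (sfStep Lc) (smStep d Lc) (StPin Lc S₁ Sinf) 1 = SPerfOf (sfStep Lc) (smStep d Lc) (fun j _ => S₁ j) 1`. -/
theorem sPerfOf_StPin_one : SPerfOf (sfStep Lc) (smStep d Lc) (StPin Lc S₁ Sinf) 1 = SPerfOf (sfStep Lc) (smStep d Lc) (fun j _ => S₁ j) 1 := by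
  unfold SPerfOf
  simp only [StPin_one]

end Pin

/-! ## §2 The `m ≥ 2` X1m-S rows of the pinned family -/

section Rows

variable (Lc : ℕ) [NeZero Lc]
  (S₁ : ℕ → Fin (d + 1) → Site (d + 1) → MKer (d + 1) (Fib d))
  (Sinf : ℕ → Fin (d + 1) → Site (d + 1) → MKer (d + 1) (Fib d))

/-- [folklore] **THE END's `hSm m` ROW, `m ≠ 1`**: one `LocStencil (Sinf m) C δ` letter gives `LocStencil (unitS (sfStep Lc j) (smStep d Lc j) (StPin … j m)) C δ` at every `j`. -/
theorem locStencil_unitS_StPin_of_ne_one {m : ℕ} (hm : m ≠ 1) {C δ : ℝ} (h : LocStencil (Sinf m) C δ) (j : ℕ) :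
    LocStencil (unitS (sfStep Lc j) (smStep d Lc j) (StPin Lc S₁ Sinf j m)) C δ := by
  rw [unitS_StPin_of_ne_one Lc S₁ Sinf hm j]
  exact h

/-- [folklore] **THE END's `hSmall m` ROW, `m ≠ 1`, WITH RATE CONSTANT `0`**: the unit-rescaled differences of the pinned family VANISH, so they are `LocStencil … (0 * θ ^ k) δ` for
any `θ`, `δ`. -/
theorem locStencil_unitS_StPin_sub_of_ne_one {m : ℕ} (hm : m ≠ 1) (θ δ : ℝ) (k j : ℕ) :
    LocStencil (unitS (sfStep Lc (k + j)) (smStep d Lc (k + j)) (StPin Lc S₁ Sinf (k + j) m) - unitS (sfStep Lc k) (smStep d Lc k) (StPin Lc S₁ Sinf k m))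
      (0 * θ ^ k) δ := by
  rw [unitS_StPin_of_ne_one Lc S₁ Sinf hm, unitS_StPin_of_ne_one Lc S₁ Sinf hm, sub_self, zero_mul]
  intro κ' u x y a b
  simp only [Pi.zero_apply, abs_zero, zero_mul, le_refl]

omit [NeZero Lc] in
/-- [folklore] **THE END's `hcov2 m` ROW, `m ≠ 1`**: a translation-covariance letter of `Sinf m` (`Sinf m κ (u + v) = shiftK (−v) (Sinf m κ u)`) passes to the pinned family at
every `j` — `unitS` acts entrywise and commutes with `shiftK`. -/
theorem StPin_translate_of_ne_one {m : ℕ} (hm : m ≠ 1) {κ : Fin (d + 1)} {u v : Site (d + 1)}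
    (hcov : Sinf m κ (u + v) = shiftK (-v) (Sinf m κ u)) (j : ℕ) :
    StPin Lc S₁ Sinf j m κ (u + v) = shiftK (-v) (StPin Lc S₁ Sinf j m κ u) := by
  rw [StPin_of_ne_one Lc S₁ Sinf hm j]
  funext x y a b
  simp only [shiftK, unitS_apply, hcov]

end Rows

/-! ## §3 The END's perfect objects under the two pins, as ONE piecewise object per `m` -/

section Perf

variable (Lc : ℕ) [NeZero Lc]
  (S₁ : ℕ → Fin (d + 1) → Site (d + 1) → MKer (d + 1) (Fib d))
  (Sinf : ℕ → Fin (d + 1) → Site (d + 1) → MKer (d + 1) (Fib d))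
  (W₁ : ℕ → Fin (d + 1) → Site (d + 1) → Fin (d + 1) → Site (d + 1) → MKer (d + 1) (Fib d))
  (Winf : ℕ → Fin (d + 1) → Site (d + 1) → Fin (d + 1) → Site (d + 1) → MKer (d + 1) (Fib d))

/-- [our object — bookkeeping] **THE END's PERFECT STENCILS UNDER THE PIN, PIECEWISE**: at `m = 1` the constructed limit of the unit-rescaled `S₁` (R-FP-41 (1): road A2's `Sinf`-shape,
`SPerfOf … (fun j _ => S₁ j) 1`), at `m ≠ 1` the supplied object `Sinf m` (R-FP-50 (b): `SfoldComp m`).  `sPerfOf_StPin` identifies it with `SPerfOf … (StPin Lc S₁ Sinf)`. -/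
def SPerfPin (m : ℕ) : Fin (d + 1) → Site (d + 1) → MKer (d + 1) (Fib d) :=
  if m = 1 then SPerfOf (sfStep Lc) (smStep d Lc) (fun j _ => S₁ j) 1 else Sinf m

/-- [our object — bookkeeping] **THE END's PERFECT SECOND-ORDER TABLES UNDER leaf-02's `WtPin`, PIECEWISE**: `m = 1` the constructed limit of the unit-rescaled `W₁`, `m ≠ 1` the
supplied object `Winf m` (R-FP-50 (b): `WtComp m`).  `wPerfOf_WtPin` identifies it with `WPerfOf … (WtPin Lc W₁ Winf)`. -/
def WPerfPin (m : ℕ) : Fin (d + 1) → Site (d + 1) → Fin (d + 1) → Site (d + 1) → MKer (d + 1) (Fib d) :=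
  if m = 1 then WPerfOf (sfStep Lc) (smStep d Lc) (fun j _ => W₁ j) 1 else Winf m

omit [NeZero Lc] in
/-- [folklore] `SPerfPin … 1 = SPerfOf … (fun j _ => S₁ j) 1`. -/
theorem SPerfPin_one : SPerfPin Lc S₁ Sinf 1 = SPerfOf (sfStep Lc) (smStep d Lc) (fun j _ => S₁ j) 1 := if_pos rfl

omit [NeZero Lc] in
/-- [folklore] `SPerfPin … m = Sinf m` for `m ≠ 1`. -/
theorem SPerfPin_of_ne_one {m : ℕ} (hm : m ≠ 1) : SPerfPin Lc S₁ Sinf m = Sinf m := if_neg hm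

omit [NeZero Lc] in
/-- [folklore] `WPerfPin … 1 = WPerfOf … (fun j _ => W₁ j) 1`. -/
theorem WPerfPin_one : WPerfPin Lc W₁ Winf 1 = WPerfOf (sfStep Lc) (smStep d Lc) (fun j _ => W₁ j) 1 := if_pos rfl

omit [NeZero Lc] in
/-- [folklore] `WPerfPin … m = Winf m` for `m ≠ 1`. -/
theorem WPerfPin_of_ne_one {m : ℕ} (hm : m ≠ 1) : WPerfPin Lc W₁ Winf m = Winf m := if_neg hm

/-- [our object — bookkeeping] **THE END's PERFECT STENCILS OF THE PINNED FAMILY ARE THE PIECEWISE OBJECT**: `SPerfOf (sfStep Lc) (smStep d Lc) (StPin Lc S₁ Sinf) = SPerfPin Lc S₁ Sinf`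
(as functions of `m`: `sPerfOf_StPin_one` ∕ `sPerfOf_StPin_of_ne_one`). -/
theorem sPerfOf_StPin : SPerfOf (sfStep Lc) (smStep d Lc) (StPin Lc S₁ Sinf) = SPerfPin Lc S₁ Sinf := by
  funext m
  by_cases hm : m = 1
  · subst hm
    rw [sPerfOf_StPin_one, SPerfPin_one]
  · rw [sPerfOf_StPin_of_ne_one Lc S₁ Sinf hm, SPerfPin_of_ne_one Lc S₁ Sinf hm]

/-- [our object — bookkeeping] **THE END's PERFECT TABLES OF leaf-02's PINNED FAMILY ARE THE PIECEWISE OBJECT**: `WPerfOf (sfStep Lc) (smStep d Lc) (WtPin Lc W₁ Winf) = WPerfPin Lc W₁ Winf`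
(`PerfectSecondOrderTablesInf.wPerfOf_WtPin_one` ∕ `wPerfOf_WtPin_of_ne_one`). -/
theorem wPerfOf_WtPin : WPerfOf (sfStep Lc) (smStep d Lc) (WtPin Lc W₁ Winf) = WPerfPin Lc W₁ Winf := by
  funext m
  by_cases hm : m = 1
  · subst hm
    rw [wPerfOf_WtPin_one, WPerfPin_one]
  · rw [wPerfOf_WtPin_of_ne_one Lc W₁ Winf hm, WPerfPin_of_ne_one Lc W₁ Winf hm]

end Perf

end Summit.QuantumFields.BalabanUV.Beta.FP.PerfectStencilPin

end
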